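import Mathlib
import Literature.Geometry.Riemannian.RiemannianCoveringCriterion
import Literature.Geometry.Lorentzian.GeodesicConfinement
import Literature.Geometry.Lorentzian.ModelDataCompletenessProofs
import Literature.Geometry.Riemannian.CartanHadamardCovering
import Literature.Geometry.Lorentzian.CauchyDevelopmentRestrict
import HarnessLib

/-!
# Crux `DrainImpliesDisperse` (stmt-FinalStateConjecture-17283), negative side, chart rigidity:
# Hadamard's global inverse function theorem on `ℝ³` (covering-space form)

Helper for the discharge of the chart-rigidity clause (P) ("entire pinched future-oriented late
charts are eventually PROPER") of the construction hypothesis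
`Negative.ProperPulsedObserverDevelopmentExists` from a GLOBAL near-Minkowski frame of the
development (`…FramedProper`): the spatial projection, in the frame, of a pinched slab is a smooth
self-map of `ℝ³` with uniformly coercive differential, and such maps are bijective with Lipschitz
inverse —

**Theorem** (Hadamard 1906; Plastock 1974, Thm. 3.3). A `C^∞` map `F : E3 → E3` with
`c ‖w‖ ≤ ‖dF_y(w)‖` for all `y, w` (`c > 0`) is a bijection (`bijective_of_le_norm_fderiv`) and
`c ‖y − y'‖ ≤ ‖F y − F y'‖` (`le_norm_sub_of_le_norm_fderiv`).

Proof. `F` is an equidimensional immersion `ℝ³ → ℝ³ = Minkowski.slice`; the pullback `F^* δ` of the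
flat metric (complete: `isComplete_trivialData_holds`) satisfies `F^*δ(w, w) = ‖dF w‖² ≥ c² ‖w‖²`, so
`ρ = √(1 + ‖y‖²)` is a proper function with `F^*δ`-gradient bounded by `c⁻¹` and `F^* δ` is
geodesically complete by Gordon's criterion (tree: `isGeodesicallyComplete_of_properFunction`);
hence `F` is a covering map onto `ℝ³` (Lee 2018, Thm. 6.23; tree:
`CartanHadamard.surjective_and_isCoveringMap_of_isGeodesicallyComplete`), hence a homeomorphism by
monodromy on the simply connected (convex) `ℝ³`. The inverse is differentiable with differential
`(dF)⁻¹` of norm `≤ c⁻¹` (inverse function theorem at each point), and the mean value inequality on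
the convex `ℝ³` gives the coercivity. Mathlib + the tree's Riemannian covering criterion; no
definitions, no named facts.

References: J. Hadamard, *Sur les transformations ponctuelles*, Bull. SMF 34 (1906) 71–84;
R. Plastock, *Homeomorphisms between Banach spaces*, Trans. AMS 200 (1974) 169–183, Thm. 3.3;
J. M. Lee, *Introduction to Riemannian Manifolds* (2nd ed., 2018), Thm. 6.23; W. B. Gordon,
Proc. AMS 37 (1973) 221–225. Line lead `prover-line-stmt-FinalStateConjecture-17283-c5-0`, 2026-08-17.
-/

noncomputable section

set_option linter.dupNamespace false -- D-0017: `Summit.<S>.<S>.…` by design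

open Set Function Filter Topology Metric
open scoped Manifold ContDiff Topology

namespace Summit.FinalStateConjecture.FinalStateConjecture.Theorems.DrainImpliesDisperse.FramedProper

open Literature.Geometry.Lorentzian Literature.Geometry.Lorentzian.PseudoRiemannianMetric
open Literature.Geometry.Riemannian

/-- A map into the full open subset `Minkowski.slice = ⊤ ⊆ E3` is `C^m` iff its underlying map is
(charts of an open submanifold are restricted charts). [folklore] -/
theorem contMDiff_toSlice_iff {m : ℕ∞ω} {F : E3 → E3} :
    ContMDiff 𝓘(ℝ, E3) 𝓘(ℝ, E3) m (fun y ↦ (⟨F y, Minkowski.mem_slice _⟩ : Minkowski.slice)) ↔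
      ContMDiff 𝓘(ℝ, E3) 𝓘(ℝ, E3) m F := by
  constructor
  · intro h y
    exact ((contMDiff_subtype_val (I := 𝓘(ℝ, E3)) (n := m) (U := Minkowski.slice)).comp h) y
  · intro h y
    have hiff : ContMDiffWithinAt 𝓘(ℝ, E3) 𝓘(ℝ, E3) m
        (Subtype.val ∘ fun y ↦ (⟨F y, Minkowski.mem_slice _⟩ : Minkowski.slice)) univ y ↔
        ContMDiffWithinAt 𝓘(ℝ, E3) 𝓘(ℝ, E3) m
          (fun y ↦ (⟨F y, Minkowski.mem_slice _⟩ : Minkowski.slice)) univ y :=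
      ChartedSpace.liftPropWithinAt_subtypeVal_comp_iff ..
    exact hiff.mp (h y).contMDiffWithinAt

/-- The differential of `y ↦ ⟨F y, _⟩ : E3 → slice` is `dF` (the inclusion has identity
differential). [folklore] -/
theorem mfderiv_toSlice_apply {F : E3 → E3} {y : E3} (hF : DifferentiableAt ℝ F y) (w : E3) :
    mfderiv 𝓘(ℝ, E3) 𝓘(ℝ, E3) (fun y ↦ (⟨F y, Minkowski.mem_slice _⟩ : Minkowski.slice)) y w =
      fderiv ℝ F y w := by
  set f : E3 → Minkowski.slice := fun y ↦ ⟨F y, Minkowski.mem_slice _⟩ with hf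
  have hFm : MDifferentiableAt 𝓘(ℝ, E3) 𝓘(ℝ, E3) F y := hF.mdifferentiableAt
  have hfm : MDifferentiableAt 𝓘(ℝ, E3) 𝓘(ℝ, E3) f y :=
    (mdifferentiableAt_subtypeVal_comp_iff Minkowski.slice (b := f)).1 hFm
  have hval : MDifferentiableAt 𝓘(ℝ, E3) 𝓘(ℝ, E3) (Subtype.val : Minkowski.slice → E3) (f y) :=
    ((contMDiff_subtype_val (I := 𝓘(ℝ, E3)) (n := ∞)).mdifferentiable (by simp)) _
  have h := mfderiv_comp y hval hfm
  have h' := DFunLike.congr_fun h w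
  rw [mfderiv_subtypeVal] at h'
  change mfderiv 𝓘(ℝ, E3) 𝓘(ℝ, E3) F y w = mfderiv 𝓘(ℝ, E3) 𝓘(ℝ, E3) f y w at h'
  rw [← h', mfderiv_eq_fderiv]
  rfl

/-- **Hadamard's global inverse function theorem on `ℝ³`, bijectivity.** A `C^∞` self-map of `E3`
with uniformly coercive differential, `c ‖w‖ ≤ ‖dF_y(w)‖` (`c > 0`), is bijective. Proof in the
module docstring (completeness of `F^*δ` by Gordon's criterion, covering by Lee's Thm. 6.23,
monodromy). Hadamard 1906; Plastock, Trans. AMS 200 (1974), Thm. 3.3; Lee 2018, Thm. 6.23.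
[cite: Lee2018, Thm. 6.23] -/
theorem bijective_of_le_norm_fderiv' (F : E3 → E3) (hF : ContDiff ℝ ∞ F) {c : ℝ} (hc : 0 < c)
    (hlow : ∀ y w : E3, c * ‖w‖ ≤ ‖fderiv ℝ F y w‖) : Bijective F := by
  -- the map into the slice, an equidimensional immersion
  set f : E3 → Minkowski.slice := fun y ↦ ⟨F y, Minkowski.mem_slice _⟩ with hfdef
  have hFd : ∀ y, DifferentiableAt ℝ F y := fun y ↦ hF.differentiable (by simp) y
  have hFm : ContMDiff 𝓘(ℝ, E3) 𝓘(ℝ, E3) ∞ F := hF.contMDiff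
  have hf : ContMDiff 𝓘(ℝ, E3) 𝓘(ℝ, E3) (∞ + 1) f :=
    (contMDiff_toSlice_iff.2 hFm).of_le (le_of_eq rfl)
  have hdf : ∀ (y : E3) (w : E3), mfderiv 𝓘(ℝ, E3) 𝓘(ℝ, E3) f y w = fderiv ℝ F y w :=
    fun y w ↦ mfderiv_toSlice_apply (hFd y) w
  have hcoer : ∀ y w : E3, fderiv ℝ F y w = 0 → w = 0 := by
    intro y w hw
    have h1 := hlow y w
    rw [hw, norm_zero] at h1
    have h2 : ‖w‖ ≤ 0 := by
      by_contra h
      push Not at h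
      linarith [mul_pos hc h]
    exact norm_le_zero_iff.1 h2
  have hf' : ∀ y, Injective (mfderiv 𝓘(ℝ, E3) 𝓘(ℝ, E3) f y) := by
    intro y w w' hww'
    have h0 : fderiv ℝ F y (show E3 from w) - fderiv ℝ F y (show E3 from w') = 0 := by
      rw [← hdf, ← hdf]
      exact sub_eq_zero.2 hww'
    have h1 : fderiv ℝ F y ((show E3 from w) - (show E3 from w')) = 0 := by
      rw [map_sub]; exact h0
    exact sub_eq_zero.1 (hcoer y _ h1)
  -- the flat metric on the slice and its pullback
  have hpb : contMDiff_pullbackBilin 𝓘(ℝ, E3) Minkowski.slice 𝓘(ℝ, E3) E3 ∞ :=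
    contMDiff_pullbackBilin_holds
  set g : PseudoRiemannianMetric 𝓘(ℝ, E3) ∞ E3 (TangentSpace 𝓘(ℝ, E3) : Minkowski.slice → Type _) :=
    trivialData.metric with hgdef
  haveI hLC : g.HasLeviCivita := g.hasLeviCivita
  have h2 : (2 : ℕ∞ω) ≤ ∞ := WithTop.coe_le_coe.2 le_top
  have hk1 : ((1 : ℕ∞) : ℕ∞ω) + 1 ≤ ∞ := by
    rw [show ((1 : ℕ∞) : ℕ∞ω) + 1 = 2 by norm_num]
    exact h2
  have hktop : ((⊤ : ℕ∞) : ℕ∞ω) + 1 ≤ ∞ := le_of_eq rfl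
  haveI : CovariantDerivative.ContMDiffCovariantDerivative g.leviCivita 1 :=
    ⟨g.isLocallyContMDiff_leviCivita_holds 1 hk1 univ isOpen_univ⟩
  haveI : CovariantDerivative.ContMDiffCovariantDerivative g.leviCivita ∞ :=
    ⟨g.isLocallyContMDiff_leviCivita_holds ⊤ hktop univ isOpen_univ⟩
  set gt := g.comap hpb f hf hf' rfl with hgt
  haveI hLCt : gt.HasLeviCivita := gt.hasLeviCivita
  haveI : CovariantDerivative.ContMDiffCovariantDerivative gt.leviCivita 1 :=
    ⟨gt.isLocallyContMDiff_leviCivita_holds 1 hk1 univ isOpen_univ⟩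
  haveI : CovariantDerivative.ContMDiffCovariantDerivative gt.leviCivita ∞ :=
    ⟨gt.isLocallyContMDiff_leviCivita_holds ⊤ hktop univ isOpen_univ⟩
  -- the pulled-back metric, pointwise: `F^*δ (w, w) = ‖dF w‖²`
  have hval : ∀ (y : E3) (a b : TangentSpace 𝓘(ℝ, E3) y),
      gt.val y a b = inner ℝ (fderiv ℝ F y (show E3 from a)) (fderiv ℝ F y (show E3 from b)) := by
    intro y a b
    show g.val (f y) (mfderiv 𝓘(ℝ, E3) 𝓘(ℝ, E3) f y a) (mfderiv 𝓘(ℝ, E3) 𝓘(ℝ, E3) f y b) = _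
    rw [hdf, hdf]
    rfl
  have hvalsq : ∀ (y : E3) (w : TangentSpace 𝓘(ℝ, E3) y),
      gt.val y w w = ‖fderiv ℝ F y (show E3 from w)‖ ^ 2 := by
    intro y w
    rw [hval, real_inner_self_eq_norm_sq]
  have hpos : ∀ (y : E3) (w : TangentSpace 𝓘(ℝ, E3) y), w ≠ 0 → 0 < gt.val y w w := by
    intro y w hw
    rw [hvalsq]
    have h1 := hlow y (show E3 from w)
    have hw' : 0 < ‖show E3 from w‖ := norm_pos_iff.2 hw
    have : 0 < ‖fderiv ℝ F y (show E3 from w)‖ := lt_of_lt_of_le (mul_pos hc hw') h1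
    positivity
  -- completeness of the flat metric on the slice
  have hcM : IsGeodesicallyComplete g.leviCivita := isComplete_trivialData_holds
  -- completeness of the pullback: Gordon's criterion with `ρ = √(1 + ‖y‖²)`
  have hcN : IsGeodesicallyComplete gt.leviCivita := by
    set B : E3 →L[ℝ] E3 →L[ℝ] ℝ := (innerSL ℝ (E := E3) : E3 →L[ℝ] E3 →L[ℝ] ℝ) with hBdef
    set ρ : E3 → ℝ := fun y ↦ Real.sqrt (1 + B y y) with hρdef
    have hBsymm : ∀ v w : E3, B v w = B w v := fun v w ↦ real_inner_comm w v
    have hBnn : ∀ v : E3, 0 ≤ B v v := fun v ↦ by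
      show 0 ≤ inner ℝ v v
      exact real_inner_self_nonneg
    have hBself : ∀ v : E3, B v v = ‖v‖ ^ 2 := fun v ↦ real_inner_self_eq_norm_sq v
    have hρpos : ∀ y : E3, 0 < ρ y := fun y ↦
      Real.sqrt_pos.2 (add_pos_of_pos_of_nonneg one_pos (hBnn y))
    have hρge : ∀ y : E3, ‖y‖ ≤ ρ y := by
      intro y
      rw [hρdef]
      show ‖y‖ ≤ Real.sqrt (1 + B y y)
      rw [hBself]
      calc ‖y‖ = Real.sqrt (‖y‖ ^ 2) := (Real.sqrt_sq (norm_nonneg _)).symm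
        _ ≤ Real.sqrt (1 + ‖y‖ ^ 2) := Real.sqrt_le_sqrt (by linarith)
    have hρd : ∀ y : E3, HasFDerivAt ρ ((1 / Real.sqrt (1 + B y y)) • B y) y :=
      fun y ↦ CartanHadamard.hasFDerivAt_sqrt_one_add B hBsymm hBnn y
    have hρm : ∀ y : E3, MDifferentiableAt 𝓘(ℝ, E3) 𝓘(ℝ, ℝ) ρ y :=
      fun y ↦ (hρd y).differentiableAt.mdifferentiableAt
    have hmv : ∀ (y : E3) (v : TangentSpace 𝓘(ℝ, E3) y),
        mvfderiv 𝓘(ℝ, E3) ρ y v = (1 / Real.sqrt (1 + B y y)) * B y v := by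
      intro y v
      show (mfderiv 𝓘(ℝ, E3) 𝓘(ℝ, ℝ) ρ y) v = _
      rw [mfderiv_eq_fderiv, (hρd y).fderiv]
      rfl
    have hdρ : ∀ (y : E3) (v : TangentSpace 𝓘(ℝ, E3) y),
        |mvfderiv 𝓘(ℝ, E3) ρ y v| ≤ c⁻¹ * Real.sqrt (gt.val y v v) := by
      intro y v
      rw [hmv, hvalsq, Real.sqrt_sq (norm_nonneg _), abs_mul, abs_of_pos (one_div_pos.2 (hρpos y))]
      -- `|⟪y, v⟫| / ρ y ≤ ‖v‖ ≤ c⁻¹ ‖dF v‖`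
      have hCS : |B y (show E3 from v)| ≤ ‖y‖ * ‖show E3 from v‖ := abs_real_inner_le_norm y _
      have h1 : 1 / Real.sqrt (1 + B y y) * |B y (show E3 from v)| ≤ ‖show E3 from v‖ := by
        rw [div_mul_eq_mul_div, one_mul, div_le_iff₀ (hρpos y)]
        calc |B y (show E3 from v)| ≤ ‖y‖ * ‖show E3 from v‖ := hCS
          _ ≤ ρ y * ‖show E3 from v‖ := mul_le_mul_of_nonneg_right (hρge y) (norm_nonneg _)
          _ = ‖show E3 from v‖ * Real.sqrt (1 + B y y) := by rw [mul_comm]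
      have h2 : ‖show E3 from v‖ ≤ c⁻¹ * ‖fderiv ℝ F y (show E3 from v)‖ := by
        rw [le_inv_mul_iff₀ hc]
        exact hlow y _
      exact h1.trans h2
    have hproper : ∀ s : ℝ, ∃ K : Set E3, IsCompact K ∧ ∀ q, ρ q ≤ s → q ∈ K := by
      intro s
      refine ⟨closedBall (0 : E3) s, isCompact_closedBall _ _, fun q hq ↦ ?_⟩
      rw [mem_closedBall, dist_zero_right]
      exact (hρge q).trans hq
    exact gt.isGeodesicallyComplete_of_properFunction h2 hpos (ρ := ρ) (L := c⁻¹)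
      (inv_nonneg.2 hc.le) hρm hdρ hproper
  -- the covering
  obtain ⟨-, hcov⟩ := CartanHadamard.surjective_and_isCoveringMap_of_isGeodesicallyComplete
    (g := g) (f := f) (hpb := hpb) (hf := hf) (hf' := hf') (hdim := rfl) hcN hcM
  -- monodromy on the simply connected slice: `f` is bijective
  haveI : ContractibleSpace Minkowski.slice := by
    have h : ContractibleSpace ((Minkowski.slice : TopologicalSpace.Opens E3) : Set E3) :=
      Convex.contractibleSpace (by rw [Minkowski.slice, TopologicalSpace.Opens.coe_top]; exact convex_univ)
        ⟨0, Minkowski.mem_slice _⟩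
    exact h
  haveI : SimplyConnectedSpace Minkowski.slice := inferInstance
  haveI : LocallyPathConnectedSpace Minkowski.slice :=
    ChartedSpace.locallyPathConnectedSpace E3 Minkowski.slice
  obtain ⟨s, ⟨hs₀, hs⟩, -⟩ :=
    hcov.existsUnique_continuousMap_lifts (ContinuousMap.id Minkowski.slice) (f 0) 0 rfl
  have hs' : f ∘ (s : Minkowski.slice → E3) = id := hs
  have hsec : (s : Minkowski.slice → E3) ∘ f = id := by
    refine hcov.eq_of_comp_eq (s.continuous.comp hcov.continuous) continuous_id ?_ 0 ?_
    · change (f ∘ (s : Minkowski.slice → E3)) ∘ f = f ∘ id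
      rw [hs']
      rfl
    · simp [hs₀]
  have hfbij : Bijective f :=
    ⟨LeftInverse.injective (g := s) fun m ↦ congrFun hsec m,
      RightInverse.surjective (g := s) fun y ↦ congrFun hs' y⟩
  -- transfer to `F = Subtype.val ∘ f`
  refine ⟨fun y y' h ↦ hfbij.1 (Subtype.ext h), fun z ↦ ?_⟩
  obtain ⟨y, hy⟩ := hfbij.2 ⟨z, Minkowski.mem_slice _⟩
  exact ⟨y, congrArg Subtype.val hy⟩

/-- **Hadamard's global inverse function theorem on `ℝ³`, coercivity.** Under the hypotheses of
`bijective_of_le_norm_fderiv'`, `c ‖y − y'‖ ≤ ‖F y − F y'‖` for all `y, y'`: the inverse of the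
bijection `F` is differentiable with differential `(dF)⁻¹` of operator norm `≤ c⁻¹` (inverse
function theorem at every point) and the mean value inequality on the convex `ℝ³` applies to it.
Plastock, Trans. AMS 200 (1974), Thm. 3.3. [cite: Lee2018, Thm. 6.23] -/
theorem le_norm_sub_of_le_norm_fderiv' (F : E3 → E3) (hF : ContDiff ℝ ∞ F) {c : ℝ} (hc : 0 < c)
    (hlow : ∀ y w : E3, c * ‖w‖ ≤ ‖fderiv ℝ F y w‖) (y y' : E3) :
    c * ‖y - y'‖ ≤ ‖F y - F y'‖ := by
  have hbij := bijective_of_le_norm_fderiv' F hF hc hlow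
  set G : E3 → E3 := Function.invFun F with hGdef
  have hGF : ∀ y, G (F y) = y := Function.leftInverse_invFun hbij.1
  have hFG : ∀ z, F (G z) = z := Function.rightInverse_invFun hbij.2
  -- the differential of `F` at each point as a continuous linear equivalence
  have hinj : ∀ y, Injective (fderiv ℝ F y) := by
    intro y w w' hww'
    have h0 : fderiv ℝ F y (w - w') = 0 := by rw [map_sub]; exact sub_eq_zero.2 hww'
    have h1 := hlow y (w - w')
    rw [h0, norm_zero] at h1
    have h2 : ‖w - w'‖ ≤ 0 := by
      by_contra h
      push Not at h
      linarith [mul_pos hc h]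
    exact sub_eq_zero.1 (norm_le_zero_iff.1 h2)
  have hGd : ∀ z : E3, ∃ L : E3 →L[ℝ] E3, HasFDerivAt G L z ∧ ‖L‖ ≤ c⁻¹ := by
    intro z
    set y := G z with hy
    set f' : E3 ≃L[ℝ] E3 :=
      (LinearMap.linearEquivOfInjective (fderiv ℝ F y).toLinearMap (hinj y) rfl).toContinuousLinearEquiv
      with hf'
    have hcoe : (f' : E3 →L[ℝ] E3) = fderiv ℝ F y := by
      ext w
      rfl
    have hstrict : HasStrictFDerivAt F (f' : E3 →L[ℝ] E3) y := by
      rw [hcoe]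
      exact (hF.contDiffAt).hasStrictFDerivAt (by simp)
    have hloc := hstrict.to_localInverse
    -- `G` agrees with the local inverse near `z = F y`
    have hev : G =ᶠ[𝓝 (F y)] hstrict.localInverse F f' y := by
      filter_upwards [hstrict.eventually_right_inverse] with w hw
      rw [← hGF (hstrict.localInverse F f' y w), hw]
    have hFy : F y = z := hFG z
    refine ⟨(f'.symm : E3 →L[ℝ] E3), ?_, ?_⟩
    · have h := hloc.hasFDerivAt.congr_of_eventuallyEq hev
      rwa [hFy] at h
    · refine ContinuousLinearMap.opNorm_le_bound _ (inv_nonneg.2 hc.le) fun w ↦ ?_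
      have h1 := hlow y (f'.symm w)
      have h2 : fderiv ℝ F y (f'.symm w) = w := by
        rw [← hcoe]
        exact f'.apply_symm_apply w
      rw [h2] at h1
      rw [le_inv_mul_iff₀ hc]
      exact h1
  have hGdiff : ∀ z ∈ (univ : Set E3), DifferentiableAt ℝ G z := fun z _ ↦
    (hGd z).choose_spec.1.differentiableAt
  have hGbound : ∀ z ∈ (univ : Set E3), ‖fderiv ℝ G z‖ ≤ c⁻¹ := fun z _ ↦ by
    obtain ⟨L, hL, hLn⟩ := hGd z
    rw [hL.fderiv]
    exact hLn
  have hMV := convex_univ.norm_image_sub_le_of_norm_fderiv_le hGdiff hGbound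
    (mem_univ (F y')) (mem_univ (F y))
  rw [hGF, hGF] at hMV
  -- `‖y − y'‖ ≤ c⁻¹ ‖F y − F y'‖`
  calc c * ‖y - y'‖ ≤ c * (c⁻¹ * ‖F y - F y'‖) := mul_le_mul_of_nonneg_left hMV hc.le
    _ = ‖F y - F y'‖ := by rw [← mul_assoc, mul_inv_cancel₀ hc.ne', one_mul]

/-- **Hadamard's global inverse function theorem on `ℝ³`, bijectivity** (registered form of
`bijective_of_le_norm_fderiv'`). Hadamard 1906; Plastock 1974, Thm. 3.3; Lee 2018, Thm. 6.23.
[cite: Lee2018, Thm. 6.23] -/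
theorem bijective_of_le_norm_fderiv : ∀ (F : Literature.Geometry.Lorentzian.E3 → Literature.Geometry.Lorentzian.E3), ContDiff ℝ ((⊤ : ℕ∞) : WithTop ℕ∞) F → ∀ {c : ℝ}, 0 < c → (∀ y w : Literature.Geometry.Lorentzian.E3, c * ‖w‖ ≤ ‖fderiv ℝ F y w‖) → Function.Bijective F := by
  intro F hF c hc hlow
  exact bijective_of_le_norm_fderiv' F hF hc hlow

/-- **Hadamard's global inverse function theorem on `ℝ³`, coercivity** (registered form of
`le_norm_sub_of_le_norm_fderiv'`). Plastock 1974, Thm. 3.3. [cite: Lee2018, Thm. 6.23] -/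
theorem le_norm_sub_of_le_norm_fderiv : ∀ (F : Literature.Geometry.Lorentzian.E3 → Literature.Geometry.Lorentzian.E3), ContDiff ℝ ((⊤ : ℕ∞) : WithTop ℕ∞) F → ∀ {c : ℝ}, 0 < c → (∀ y w : Literature.Geometry.Lorentzian.E3, c * ‖w‖ ≤ ‖fderiv ℝ F y w‖) → ∀ y y' : Literature.Geometry.Lorentzian.E3, c * ‖y - y'‖ ≤ ‖F y - F y'‖ := by
  intro F hF c hc hlow y y'
  exact le_norm_sub_of_le_norm_fderiv' F hF hc hlow y y'

end Summit.FinalStateConjecture.FinalStateConjecture.Theorems.DrainImpliesDisperse.FramedProper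

end
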